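import Summits.ValiantsHypothesis.ValiantsHypothesis.Theses.PolyaContinued
import Summits.ValiantsHypothesis.ValiantsHypothesis.Theorems.PolyaContinuedMonotoneCoverHardRectangleCount

/-!
# Route `PolyaContinued`, crux `MonotoneCoverHard` (stmt-ValiantsHypothesis-7421), line `few-state-cut`:
# the registered stub `stub_rectangleBound` — part 3 of 3

`stub_rectangleBound` of `Cruxes/MonotoneCoverHard/Lines/few_state_cut.lean` (registered on item 7421 by
planner val-width-lines-1, 2026-08-27; byte-identical after the 2026-08-27 reshape of `stub_fewStateCut`),
proved VERBATIM (same binders, same `open`s, `open scoped Classical`), `--supports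
stmt-ValiantsHypothesis-7421`.  Statement: for a Pfaffian cover `E ⊆ Fin m × Fin m` with a
`0 / 1 / variable` labelling `a` such that `per_n = aeval a PM_E`, and a vertex cut `S` that is balanced
for every weight-nonzero perfect matching (`n ≤ 3k ≤ 2n`, `k` = number of variable-labelled edges with
both ends in `S`), the number of crossing states `{M ∩ ∂S}` is at least `2^(n/3)`.

Proof.  (1) LABELS (`exists_labels`): `a e = monomial (δ e) 1` on nonzero edges with `δ e` a unit
vector or `0`.  (2) EXPANSION (`aeval_permanent_cover`, `perPoly_eq_sum_monomial`): both sides of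
`per_n = aeval a PM_E` are sums of monic monomials, over `S_n` (exponents `∑ k, single (k, σ k) 1`) and
over the good matchings `G` (exponents `∑ i, δ (i, τ i)`).  (3) LABEL BIJECTION (`label_bijection`):
comparing coefficients in characteristic `0`, the exponent map is injective on `G` with image exactly the
permutation exponents — no cancellation can occur among coefficient-`1` monomials.  (4) The abstract
rectangle count `two_pow_le_card_states` of part 2, with `k(τ)` = degree of the inside part of the
exponent, which equals the stub's filter cardinality (`hcount`).  The Pfaffian hypothesis is not used
(the bound holds for every label-bijective cover).  Method: Jerrum–Snir / Nisan rectangle counting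
[folklore]; no new definitions.

HONEST FRAMING: this is the bankable counting half of the line; the line's bet is `stub_fewStateCut`
(open, XL).  `MonotoneCoverHard` itself is open and strictly weaker than the route target; VP ≠ VNP is not
moved by this file.
-/

namespace Summit.ValiantsHypothesis.ValiantsHypothesis.Theorems.PolyaContinued.MonotoneCoverHardRectangle

set_option linter.dupNamespace false

/-! ### Label extraction from the polynomial identity -/

section Labels

open Finset Equiv MvPolynomial

/-- Coefficient comparison: a sum of monic monomials over `G` equal to a sum of monic monomials over
an injectively-labelled `Fintype` forces a label bijection. -/
theorem label_bijection {α β ι : Type*} [Fintype β] (G : Finset α) (d : α → ι →₀ ℕ)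
    (e : β → ι →₀ ℕ) (he : Function.Injective e)
    (h : ∑ τ ∈ G, monomial (d τ) (1 : ℂ) = ∑ σ : β, monomial (e σ) (1 : ℂ)) :
    (∀ τ ∈ G, ∀ τ' ∈ G, d τ = d τ' → τ = τ') ∧ (∀ τ ∈ G, ∃ σ, d τ = e σ) ∧
      (∀ σ, ∃ τ ∈ G, d τ = e σ) := by
  classical
  have hcoef : ∀ x : ι →₀ ℕ,
      (G.filter fun τ => d τ = x).card = (univ.filter fun σ => e σ = x).card := by
    intro x
    have h1 := congrArg (coeff x) h
    simp only [coeff_sum, coeff_monomial] at h1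
    rw [Finset.sum_boole, Finset.sum_boole] at h1
    exact_mod_cast h1
  have hle : ∀ x, (univ.filter fun σ => e σ = x).card ≤ 1 := by
    intro x
    refine Finset.card_le_one.2 fun σ hσ σ' hσ' => he ?_
    rw [(Finset.mem_filter.1 hσ).2, (Finset.mem_filter.1 hσ').2]
  refine ⟨?_, ?_, ?_⟩
  · intro τ hτ τ' hτ' hd
    have h1 : (G.filter fun τ'' => d τ'' = d τ').card ≤ 1 := by rw [hcoef]; exact hle _
    exact Finset.card_le_one.1 h1 τ (Finset.mem_filter.2 ⟨hτ, hd⟩) τ'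
      (Finset.mem_filter.2 ⟨hτ', rfl⟩)
  · intro τ hτ
    have h1 : 0 < (G.filter fun τ' => d τ' = d τ).card :=
      Finset.card_pos.2 ⟨τ, Finset.mem_filter.2 ⟨hτ, rfl⟩⟩
    rw [hcoef] at h1
    obtain ⟨σ, hσ⟩ := Finset.card_pos.1 h1
    exact ⟨σ, ((Finset.mem_filter.1 hσ).2).symm⟩
  · intro σ
    have h1 : 0 < (univ.filter fun σ' => e σ' = e σ).card :=
      Finset.card_pos.2 ⟨σ, Finset.mem_filter.2 ⟨Finset.mem_univ _, rfl⟩⟩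
    rw [← hcoef] at h1
    obtain ⟨τ, hτ⟩ := Finset.card_pos.1 h1
    exact ⟨τ, (Finset.mem_filter.1 hτ).1, (Finset.mem_filter.1 hτ).2⟩

/-- The labels of a `0 / 1 / variable` projection as exponent vectors. -/
theorem exists_labels {m n : ℕ} (a : Fin m × Fin m → MvPolynomial (Fin n × Fin n) ℂ)
    (ha : ∀ e, (∃ j, a e = MvPolynomial.X j) ∨ a e = 0 ∨ a e = 1) :
    ∃ δ : Fin m × Fin m → (Fin n × Fin n →₀ ℕ),
      (∀ e, a e ≠ 0 → a e = monomial (δ e) 1) ∧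
      (∀ e, (∃ j, a e = MvPolynomial.X j) → Finsupp.degree (δ e) = 1) ∧
      (∀ e, ¬ (∃ j, a e = MvPolynomial.X j) → δ e = 0) := by
  classical
  refine ⟨fun e => if h : ∃ j, a e = MvPolynomial.X j then Finsupp.single h.choose 1 else 0,
    ?_, ?_, ?_⟩
  · intro e hne
    by_cases h : ∃ j, a e = MvPolynomial.X j
    · simp only [dif_pos h]
      calc a e = MvPolynomial.X h.choose := h.choose_spec
        _ = monomial (Finsupp.single h.choose 1) 1 := rfl
    · simp only [dif_neg h]
      rcases ha e with h' | h' | h'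
      · exact absurd h' h
      · exact absurd h' hne
      · rw [h']; simp
  · intro e h
    simp only [dif_pos h, Finsupp.degree_single]
  · intro e h
    simp only [dif_neg h]

/-- Expansion of the projected perfect-matching polynomial of the cover as a sum of monic monomials
over the GOOD matchings (those avoiding non-edges and `0`-labelled edges). -/
theorem aeval_permanent_cover {m n : ℕ} (E : Finset (Fin m × Fin m))
    (a : Fin m × Fin m → MvPolynomial (Fin n × Fin n) ℂ)
    (δ : Fin m × Fin m → (Fin n × Fin n →₀ ℕ)) (hδ : ∀ e, a e ≠ 0 → a e = monomial (δ e) 1)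
    (G : Finset (Perm (Fin m)))
    (hG : G = univ.filter fun τ : Perm (Fin m) => ∀ i, (i, τ i) ∈ E ∧ a (i, τ i) ≠ 0) :
    MvPolynomial.aeval a (Matrix.of fun i j => if (i, j) ∈ E then MvPolynomial.X (i, j) else 0 :
        Matrix (Fin m) (Fin m) (MvPolynomial (Fin m × Fin m) ℂ)).permanent =
      ∑ τ ∈ G, monomial (∑ i, δ (i, τ i)) 1 := by
  classical
  rw [← Matrix.permanent_transpose]
  simp only [Matrix.permanent, Matrix.transpose_apply, Matrix.of_apply, map_sum, map_prod]
  have hfac : ∀ e : Fin m × Fin m,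
      MvPolynomial.aeval a (if e ∈ E then MvPolynomial.X e else 0 : MvPolynomial _ ℂ) =
        if e ∈ E then a e else 0 := by
    intro e; split_ifs <;> simp
  simp_rw [hfac]
  have hzero : ∀ τ : Perm (Fin m), ¬ (∀ i, (i, τ i) ∈ E ∧ a (i, τ i) ≠ 0) →
      (∏ i, (if (i, τ i) ∈ E then a (i, τ i) else 0)) = 0 := by
    intro τ hτ
    obtain ⟨i, hi⟩ := not_forall.1 hτ
    apply Finset.prod_eq_zero (Finset.mem_univ i)
    by_cases h1 : (i, τ i) ∈ E
    · rw [if_pos h1]; by_contra h2; exact hi ⟨h1, h2⟩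
    · rw [if_neg h1]
  have hgood : ∀ τ : Perm (Fin m), (∀ i, (i, τ i) ∈ E ∧ a (i, τ i) ≠ 0) →
      (∏ i, (if (i, τ i) ∈ E then a (i, τ i) else 0)) = monomial (∑ i, δ (i, τ i)) 1 := by
    intro τ hτ
    rw [monomial_sum_one]
    refine Finset.prod_congr rfl fun i _ => ?_
    rw [if_pos (hτ i).1, hδ _ (hτ i).2]
  calc ∑ τ : Perm (Fin m), ∏ i, (if (i, τ i) ∈ E then a (i, τ i) else 0)
      = ∑ τ ∈ univ.filter (fun τ : Perm (Fin m) => ∀ i, (i, τ i) ∈ E ∧ a (i, τ i) ≠ 0),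
          ∏ i, (if (i, τ i) ∈ E then a (i, τ i) else 0) :=
        (Finset.sum_filter_of_ne fun τ _ hne => by by_contra h; exact hne (hzero τ h)).symm
    _ = ∑ τ ∈ univ.filter (fun τ : Perm (Fin m) => ∀ i, (i, τ i) ∈ E ∧ a (i, τ i) ≠ 0),
          monomial (∑ i, δ (i, τ i)) 1 :=
        Finset.sum_congr rfl fun τ hτ => hgood τ (Finset.mem_filter.1 hτ).2
    _ = ∑ τ ∈ G, monomial (∑ i, δ (i, τ i)) 1 := by rw [hG]

/-- The generic permanent as a sum of monic monomials over permutation exponents. -/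
theorem perPoly_eq_sum_monomial (n : ℕ) :
    Literature.Computability.AlgebraicComplexity.perPoly (Fin n) ℂ =
      ∑ σ : Perm (Fin n), monomial (∑ k, Finsupp.single (k, σ k) 1) (1 : ℂ) := by
  unfold Literature.Computability.AlgebraicComplexity.perPoly
  rw [← Matrix.permanent_transpose]
  simp only [Matrix.permanent, Matrix.transpose_apply, Matrix.mvPolynomialX_apply]
  refine Finset.sum_congr rfl fun σ _ => ?_
  rw [monomial_sum_one]
  rfl

end Labels

/-! ### The registered stub -/

section Stub

open Literature.Computability.AlgebraicComplexity
open Summit.ValiantsHypothesis.ValiantsHypothesis.Theses.PolyaContinued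
open scoped Classical

/-- STUB 2 — RECTANGLE COUNTING: a balanced cut of a label-bijective Pfaffian cover of `S_n` has at least
`2^(n/3)` matching states. -/
theorem stub_rectangleBound :
    ∀ (n m : ℕ) (E : Finset (Fin m × Fin m))
      (a : Fin m × Fin m → MvPolynomial (Fin n × Fin n) ℂ),
      (∃ s : Fin m × Fin m → ℂ, (∀ e, s e = 1 ∨ s e = -1) ∧
        (Matrix.of fun i j => if (i, j) ∈ E then MvPolynomial.C (s (i, j)) * MvPolynomial.X (i, j)
            else 0 : Matrix (Fin m) (Fin m) (MvPolynomial (Fin m × Fin m) ℂ)).det =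
          (Matrix.of fun i j => if (i, j) ∈ E then MvPolynomial.X (i, j) else 0 :
            Matrix (Fin m) (Fin m) (MvPolynomial (Fin m × Fin m) ℂ)).permanent) →
      (∀ e, (∃ j, a e = MvPolynomial.X j) ∨ a e = 0 ∨ a e = 1) →
      Literature.Computability.AlgebraicComplexity.perPoly (Fin n) ℂ =
        MvPolynomial.aeval a (Matrix.of fun i j => if (i, j) ∈ E then MvPolynomial.X (i, j) else 0 :
            Matrix (Fin m) (Fin m) (MvPolynomial (Fin m × Fin m) ℂ)).permanent →
      ∀ S : Finset (Fin m ⊕ Fin m),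
        (∀ τ : Equiv.Perm (Fin m), (∀ i, (i, τ i) ∈ E ∧ a (i, τ i) ≠ 0) →
          n ≤ 3 * (Finset.univ.filter fun i : Fin m =>
              Sum.inl i ∈ S ∧ Sum.inr (τ i) ∈ S ∧ ∃ j, a (i, τ i) = MvPolynomial.X j).card ∧
          3 * (Finset.univ.filter fun i : Fin m =>
              Sum.inl i ∈ S ∧ Sum.inr (τ i) ∈ S ∧ ∃ j, a (i, τ i) = MvPolynomial.X j).card ≤ 2 * n) →
        2 ^ (n / 3) ≤
          ((Finset.univ.filter fun τ : Equiv.Perm (Fin m) => ∀ i, (i, τ i) ∈ E ∧ a (i, τ i) ≠ 0).image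
            (fun τ : Equiv.Perm (Fin m) => (Finset.univ.filter fun i : Fin m =>
              (Sum.inl i ∈ S ∧ Sum.inr (τ i) ∉ S) ∨ (Sum.inl i ∉ S ∧ Sum.inr (τ i) ∈ S)).image
                fun i => (i, τ i))).card := by
  intro n m E a _ ha hper S hbal
  obtain ⟨δ, hδ, hδ1, hδ0⟩ := exists_labels a ha
  set G := Finset.univ.filter fun τ : Equiv.Perm (Fin m) => ∀ i, (i, τ i) ∈ E ∧ a (i, τ i) ≠ 0
    with hG
  have hsum : ∑ τ ∈ G, MvPolynomial.monomial (∑ i, δ (i, τ i)) (1 : ℂ) =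
      ∑ σ : Equiv.Perm (Fin n), MvPolynomial.monomial (∑ k, Finsupp.single (k, σ k) 1) (1 : ℂ) := by
    rw [← aeval_permanent_cover E a δ hδ G hG, ← hper, perPoly_eq_sum_monomial]
  obtain ⟨hinj, himg, hsurj⟩ := label_bijection G (fun τ => ∑ i, δ (i, τ i))
    (fun σ : Equiv.Perm (Fin n) => ∑ k, Finsupp.single (k, σ k) (1 : ℕ)) pexp_injective hsum
  have hdeg : ∀ e, Finsupp.degree (δ e) = if (∃ j, a e = MvPolynomial.X j) then 1 else 0 := by
    intro e
    split_ifs with h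
    · exact hδ1 e h
    · rw [hδ0 e h, map_zero]
  have hcount : ∀ τ : Equiv.Perm (Fin m),
      (Finset.univ.filter fun i : Fin m =>
          Sum.inl i ∈ S ∧ Sum.inr (τ i) ∈ S ∧ ∃ j, a (i, τ i) = MvPolynomial.X j).card =
        Finsupp.degree (∑ i ∈ Finset.univ.filter
          (fun i : Fin m => Sum.inl i ∈ S ∧ Sum.inr (τ i) ∈ S), δ (i, τ i)) := by
    intro τ
    rw [map_sum]
    simp_rw [hdeg]
    rw [Finset.sum_boole, Nat.cast_id, Finset.filter_filter]
    congr 1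
    exact Finset.filter_congr fun i _ => and_assoc.symm
  refine two_pow_le_card_states S δ (fun e => e ∈ E ∧ a e ≠ 0) G
    (fun τ => ∑ i, δ (i, τ i)) _ _ _ _ _ (fun τ => by rw [hG]; simp) (fun _ => rfl) (fun _ => rfl)
    (fun _ => rfl) (fun _ => rfl) (fun _ => rfl) (fun _ => rfl) hinj himg hsurj ?_
  intro τ hτ
  rw [← hcount τ]
  exact hbal τ (by rw [hG] at hτ; exact (Finset.mem_filter.1 hτ).2)

end Stub

end Summit.ValiantsHypothesis.ValiantsHypothesis.Theorems.PolyaContinued.MonotoneCoverHardRectangle
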